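import Summits.BirchSwinnertonDyer.Rank1Residual.GaloisImage.SmallImageSemisimpleInertia
import HarnessLib

/-!
# The inertia image `e_p(I) = #ρ̄_{E,p}(I)` has order PRIME TO `p` on a small image and on a
# stable pair — the bridge "TB-TAME-e3" between the O8-TAME keys (`InertiaSplitAt`, stable pairs)
# and the tame-tower vocabulary `Nat.card ((𝔓.inertia Γ_ℚ).map (galoisRepTorsion W p))` of
# `GaloisImage/ThreeTorsionInertiaTame.lean` (row T-b9, seat p02) — part 4 of the O8-TAME kernel
# theorems (cell `b2b-bsdres`, lane CLASS-CLOSURE, seat cc-typer-1 = typer of record N11 / O8;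
# `class-closure/O8/STATEMENT.md` §§12–15; joint small-image axis O8 / N2 = X10b@3 / N3 = X9@{5,7})

HONEST FRAMING (cell `b2b-bsdres`, run/shared/lean/b2b/bsd-rank1-residual/, verbatim in every
file): the goal of the cell is to DELETE the COMBINATION-SHAPED residual classes of the
Birch–Swinnerton-Dyer formula for ALL analytic-rank `≤ 1` elliptic curves over `ℚ` — "full BSD
formula for every rank `≤ 1` curve in class `C`" assembled STRICTLY from published theorems — so
that the rank-`≤ 1` remainder becomes exactly the CONSTRUCTION-SHAPED classes, which are TYPED
(missing-input `Prop`s), NOT attempted. This is not "finishing BSD". Lane CLASS-CLOSURE: research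
routes, no claim beyond the stated classes; census output = EVIDENCE, never a Literature fact;
NOTHING is booked here. This file contains THEOREMS ONLY (finite group theory of the image of
`ρ̄_{E,p}` and linear algebra on the `𝔽_p`-plane `E[p]`, over tree predicates); no definition, no
named fact, no conjecture, no `sorry`.

## What is proved

Write `ρ̄ = ρ̄_{E,p} = galoisRepTorsion W p : Γ_ℚ → Aut(E[p])` and, for a subgroup `H ≤ Γ_ℚ`,
`e_p(H) := #ρ̄(H) = Nat.card (H.map ρ̄)` (for `H = I_𝔓`, `𝔓 ∣ p`, this is the ramification index of
`ℚ(E[p])/ℚ` at `𝔓`, the `e₃` of `GaloisImage/ThreeTorsionInertiaTame.lean`).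

* §7 `not_dvd_card_map_galoisRepTorsion_of_irr_of_not_surj` — **small image ⟹ `p ∤ e_p(H)` for
  EVERY `H ≤ Γ_ℚ`**: `#ρ̄(Γ_ℚ)` is prime to `p` (Serre 1972 Prop. 15 backwards, tree
  `not_dvd_card_of_not_hasSurjectiveModNGaloisRep`) and `ρ̄(H) ≤ ρ̄(Γ_ℚ)` (Lagrange). Class forms
  `Additive.O8.not_dvd_card_map_galoisRepTorsion` (O8: EVERY row, all reduction types — also the
  potentially supersingular ones), `ClassX9.not_dvd_card_map_galoisRepTorsion` (N3),
  `ClassX10.not_dvd_card_map_galoisRepTorsion_of_not_surj` (N2): on the three small-image classes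
  `ρ̄_{E,p}` is TAMELY RAMIFIED at `p` (and everywhere), with no binder.
* §8 `not_dvd_card_map_galoisRepTorsion_of_stablePair` — **stable pair ⟹ `p ∤ e_p(I)`**: if
  `E[p] = X ⊕ Y` with both lines `I`-stable then every `σ ∈ I` acts on `X`, `Y` by scalars, so
  `σ^{p−1}` acts trivially (Fermat; `pow_sub_one_smul_eq_self_of_stablePair`) and every element of
  `ρ̄(I)` has order dividing `p − 1`; an element of order `p` (Cauchy) is impossible. Corollary
  `not_dvd_card_map_galoisRepTorsion_of_inertiaSplitAt` (the `p = 3` key TAME ⟹ `p ∤ e_p`).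

READING (class-closure; `O8/STATEMENT.md` §15; `N11/SUBPARTITION-typed.md` row TAME): the three
formulations of "tame at `p`" used in the cell — (i) `p ∤ e_p(I_𝔓)` (p02's tame tower, row T-b9),
(ii) `InertiaSplitAt` / stable pair (this seat, parts 2–3), (iii) small image `Irr ∧ ¬Surj` — are
related by THEOREMS: (iii) ⟹ (i) for every subgroup (§7); (iii) ∧ "a stable line exists" ⟹ (ii)
(part 3); (ii) ⟹ (i) (§8). The converse (i) ∧ "a stable line" ⟹ (ii) (Maschke) is NOT proved here.
On N11's SURJECTIVE rows none of this applies (`3 ∣ e₃` happens: p02's CASE B). Nothing about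
BSD_p; O8 / N2 / N3 stay OPEN; nothing is booked.

References: J.-P. Serre, Invent. Math. 15 (1972) §2.4 Prop. 15 [Serre1972]; J.-P. Serre, *Local
Fields* Ch. IV §2 Cor. 1–3 [SerreLocalFields1979]; B. Edixhoven (1997) §4.2 [Edixhoven1997Serre];
class-closure/O8/STATEMENT.md §§12–15.
-/

set_option autoImplicit false

noncomputable section

open scoped Classical

open WeierstrassCurve Literature.NumberTheory.EllipticCurves Literature.NumberTheory.GaloisRepresentations
  Field IsDedekindDomain NumberField
  Literature.NumberTheory.EllipticCurves.Rank1Residual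
  Summit.BirchSwinnertonDyer.Rank1Residual.Additive.MixedCongruence

namespace Summit.BirchSwinnertonDyer.Rank1Residual.GaloisImage

variable {W : WeierstrassCurve ℚ} [W.IsElliptic] {p : ℕ} [Fact p.Prime]

/-! ## §7. Small image ⟹ every `ρ̄(H)` has order prime to `p` -/

variable (W p) in
/-- **Small image ⟹ `p ∤ #ρ̄_{E,p}(H)` for every subgroup `H ≤ Γ_ℚ`** (in particular for every
inertia group `I_𝔓`, `𝔓 ∣ p`: `ρ̄_{E,p}` is tamely ramified at `p`). `#ρ̄(Γ_ℚ)` is prime to `p` for an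
irreducible non-surjective `ρ̄` (Serre Prop. 15; `not_dvd_card_of_not_hasSurjectiveModNGaloisRep`)
and `#ρ̄(H) ∣ #ρ̄(Γ_ℚ)`. [cite: Serre1972, §2.4 Prop. 15] -/
theorem not_dvd_card_map_galoisRepTorsion_of_irr_of_not_surj (hirr : Irr W p) (hns : ¬ Surj W p)
    (H : Subgroup (absoluteGaloisGroup ℚ)) :
    ¬ p ∣ Nat.card (H.map (galoisRepTorsion W p)) := by
  intro h
  obtain ⟨e, Φ, he, -⟩ := exists_frame_galoisRepTorsion_rat W p
  have hG : ¬ p ∣ Nat.card (galoisRepTorsion W p).range := by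
    rw [← card_map_range_galoisRepTorsion W p Φ]
    exact not_dvd_card_of_not_hasSurjectiveModNGaloisRep W p Φ e he hirr hns
  exact hG (h.trans (Subgroup.card_dvd_of_le (Subgroup.map_le_range (galoisRepTorsion W p) H)))

/-! ## §8. A stable pair ⟹ `ρ̄(I)` has exponent dividing `p − 1`, hence order prime to `p` -/

omit [W.IsElliptic] [Fact p.Prime] in
/-- On a line it stabilises, a Galois element acting by the scalar `c` has `σ^k = c^k`. [folklore] -/
theorem pow_smul_eq_pow_zsmul_of_forall_mem {L : AddSubgroup (geomTorsion W (p : ℤ))}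
    {σ : absoluteGaloisGroup ℚ} {c : ℤ} (hc : ∀ P ∈ L, σ • P = c • P) (k : ℕ)
    {P : geomTorsion W (p : ℤ)} (hP : P ∈ L) : σ ^ k • P = c ^ k • P := by
  induction k with
  | zero => rw [pow_zero, pow_zero, one_smul, one_smul]
  | succ k ih =>
    rw [pow_succ', mul_smul, ih, smul_comm σ (c ^ k) P, hc P hP, smul_smul, ← pow_succ]

omit [W.IsElliptic] in
/-- **Stable pair ⟹ `σ^{p−1}` acts trivially** for `σ ∈ I`: `σ` acts on the two `I`-stable lines
`X`, `Y` by scalars invertible mod `p`, whose `(p−1)`-st powers are `≡ 1` (Fermat), and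
`E[p] = X + Y`. [folklore] -/
theorem pow_sub_one_smul_eq_self_of_stablePair {I : Subgroup (absoluteGaloisGroup ℚ)}
    (h : ∃ X Y : AddSubgroup (geomTorsion W (p : ℤ)), Nat.card X = p ∧ Nat.card Y = p ∧
      X ⊓ Y = ⊥ ∧ X ⊔ Y = ⊤ ∧
      (∀ σ ∈ I, ∀ P ∈ X, σ • P ∈ X) ∧ (∀ σ ∈ I, ∀ P ∈ Y, σ • P ∈ Y))
    {σ : absoluteGaloisGroup ℚ} (hσ : σ ∈ I) (P : geomTorsion W (p : ℤ)) :
    σ ^ (p - 1) • P = P := by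
  obtain ⟨X, Y, hX, hY, -, hsup, hXst, hYst⟩ := h
  obtain ⟨c, hc⟩ := exists_int_forall_mem_smul_eq_zsmul hX (hXst σ hσ)
  obtain ⟨d, hd⟩ := exists_int_forall_mem_smul_eq_zsmul hY (hYst σ hσ)
  have hc1 : ((c ^ (p - 1) : ℤ) : ZMod p) = 1 := by
    rw [Int.cast_pow]
    exact ZMod.pow_card_sub_one_eq_one (intCast_ne_zero_of_forall_mem_smul_eq_zsmul hX hc)
  have hd1 : ((d ^ (p - 1) : ℤ) : ZMod p) = 1 := by
    rw [Int.cast_pow]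
    exact ZMod.pow_card_sub_one_eq_one (intCast_ne_zero_of_forall_mem_smul_eq_zsmul hY hd)
  have hP : P ∈ X ⊔ Y := hsup ▸ AddSubgroup.mem_top P
  obtain ⟨x, hx, y, hy, rfl⟩ := AddSubgroup.mem_sup.mp hP
  rw [smul_add, pow_smul_eq_pow_zsmul_of_forall_mem hc (p - 1) hx,
    pow_smul_eq_pow_zsmul_of_forall_mem hd (p - 1) hy, zsmul_eq_self_of_intCast_eq_one hc1,
    zsmul_eq_self_of_intCast_eq_one hd1]

/-- **Stable pair ⟹ `p ∤ #ρ̄_{E,p}(I)`.** Every element of `ρ̄(I)` is killed by `p − 1`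
(`pow_sub_one_smul_eq_self_of_stablePair`), so an element of order `p` — which exists as soon as
`p ∣ #ρ̄(I)` (Cauchy) — is impossible. [cite: SerreLocalFields1979, Ch. IV §2 Cor. 1–3]
[cite: Edixhoven1997Serre, §4.2 (PDF p. 297)] -/
theorem not_dvd_card_map_galoisRepTorsion_of_stablePair {I : Subgroup (absoluteGaloisGroup ℚ)}
    (h : ∃ X Y : AddSubgroup (geomTorsion W (p : ℤ)), Nat.card X = p ∧ Nat.card Y = p ∧
      X ⊓ Y = ⊥ ∧ X ⊔ Y = ⊤ ∧
      (∀ σ ∈ I, ∀ P ∈ X, σ • P ∈ X) ∧ (∀ σ ∈ I, ∀ P ∈ Y, σ • P ∈ Y)) :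
    ¬ p ∣ Nat.card (I.map (galoisRepTorsion W p)) := by
  have hp : p.Prime := Fact.out
  intro hdvd
  -- `Aut(E[p])` is finite, so Cauchy applies to `ρ̄(I)`
  have hE := Literature.NumberTheory.EllipticCurves.natCard_geomTorsion W p
  haveI : Finite (geomTorsion W (p : ℤ)) :=
    Nat.finite_of_card_ne_zero (by rw [hE]; exact pow_ne_zero 2 hp.ne_zero)
  haveI : Finite (AddAut (geomTorsion W (p : ℤ))) := DFunLike.finite _
  haveI : Finite (Multiplicative (AddAut (geomTorsion W (p : ℤ)))) := inferInstance
  obtain ⟨g, hg⟩ := exists_prime_orderOf_dvd_card' (G := I.map (galoisRepTorsion W p)) p hdvd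
  obtain ⟨σ, hσ, hσg⟩ := Subgroup.mem_map.mp g.2
  -- `ρ̄(σ)^{p-1} = 1`
  have hpow : galoisRepTorsion W p σ ^ (p - 1) = 1 := by
    rw [← map_pow, galoisRepTorsion_eq_one_iff']
    exact pow_sub_one_smul_eq_self_of_stablePair h hσ
  have hord : orderOf (galoisRepTorsion W p σ) = p := by
    rw [hσg, Subgroup.orderOf_coe, hg]
  have h1 : orderOf (galoisRepTorsion W p σ) ∣ p - 1 := orderOf_dvd_of_pow_eq_one hpow
  rw [hord] at h1
  have h2 := Nat.le_of_dvd (by have := hp.two_le; omega) h1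
  have := hp.two_le
  omega

/-- **TAME (`InertiaSplitAt`, the `p = 3` key) ⟹ `p ∤ #ρ̄_{E,p}(I)`.**
[cite: SerreLocalFields1979, Ch. IV §2 Cor. 1–3] -/
theorem not_dvd_card_map_galoisRepTorsion_of_inertiaSplitAt {I : Subgroup (absoluteGaloisGroup ℚ)}
    (h : InertiaSplitAt W p I) : ¬ p ∣ Nat.card (I.map (galoisRepTorsion W p)) :=
  not_dvd_card_map_galoisRepTorsion_of_stablePair (exists_stablePair_of_inertiaSplitAt h)

variable (W p) in
/-- **N3 = class X9 ⟹ `p ∤ #ρ̄_{E,p}(H)` for every `H ≤ Γ_ℚ`** (tamely ramified at `p`; no binder).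
[cite: Serre1972, §2.4 Prop. 15] -/
theorem ClassX9.not_dvd_card_map_galoisRepTorsion [W.IsGloballyMinimal] (h : ClassX9 W p)
    (H : Subgroup (absoluteGaloisGroup ℚ)) : ¬ p ∣ Nat.card (H.map (galoisRepTorsion W p)) :=
  not_dvd_card_map_galoisRepTorsion_of_irr_of_not_surj W p h.2.2.2.1 h.2.2.2.2.1 H

variable (W p) in
/-- **N2 = X10b (class X10, `ρ̄_{E,3}` not onto) ⟹ `3 ∤ #ρ̄_{E,3}(H)` for every `H ≤ Γ_ℚ`**: in
p02's notation `3 ∤ e₃` on every X10b row (contrast N11's surjective rows, where `3 ∣ e₃` occurs).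
[cite: Serre1972, §2.4 Prop. 15] -/
theorem ClassX10.not_dvd_card_map_galoisRepTorsion_of_not_surj [W.IsGloballyMinimal]
    (h : ClassX10 W p) (hns : ¬ Surj W 3) (H : Subgroup (absoluteGaloisGroup ℚ)) :
    ¬ 3 ∣ Nat.card (H.map (galoisRepTorsion W 3)) :=
  not_dvd_card_map_galoisRepTorsion_of_irr_of_not_surj W 3 h.2.2.1 hns H

end Summit.BirchSwinnertonDyer.Rank1Residual.GaloisImage

/-! ## §9. O8 forms -/

namespace Summit.BirchSwinnertonDyer.Rank1Residual.Additive

open Summit.BirchSwinnertonDyer.Rank1Residual.GaloisImage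

variable (W : WeierstrassCurve ℚ) [W.IsElliptic] (p : ℕ) [Fact p.Prime]

/-- **O8 ⟹ `p ∤ #ρ̄_{E,p}(H)` for every subgroup `H ≤ Γ_ℚ`** — on EVERY O8 row (all reduction
types at `p`, potentially supersingular included) `ρ̄_{E,p}` is tamely ramified at `p`: in p02's
notation `p ∤ e_p(I_𝔓)`. No binder. [cite: Serre1972, §2.4 Prop. 15] -/
theorem O8.not_dvd_card_map_galoisRepTorsion (hX : ClassX4 W p) (hns : ¬ Surj W p)
    (H : Subgroup (absoluteGaloisGroup ℚ)) : ¬ p ∣ Nat.card (H.map (galoisRepTorsion W p)) :=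
  not_dvd_card_map_galoisRepTorsion_of_irr_of_not_surj W p hX.2.2 hns H

/-- **O8, inertia form:** `p ∤ #ρ̄_{E,p}(I_𝔓)` at every prime `𝔓` of `ℤ̄`. [cite: Serre1972, §2.4 Prop. 15] -/
theorem O8.not_dvd_card_inertia_map_galoisRepTorsion (hX : ClassX4 W p) (hns : ¬ Surj W p)
    (𝔓 : Ideal (absIntegers (𝓞 ℚ) ℚ)) :
    ¬ p ∣ Nat.card ((𝔓.inertia (absoluteGaloisGroup ℚ)).map (galoisRepTorsion W p)) :=
  O8.not_dvd_card_map_galoisRepTorsion W p hX hns _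

end Summit.BirchSwinnertonDyer.Rank1Residual.Additive

end
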